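import Literature.NumberTheory.LFunctions.ThetaChainCheck
import HarnessLib

/-!
# Rosser–Schoenfeld's (3.22) on a finite range by kernel computation: the checker

Topic: `Literature/NumberTheory/LFunctions`. Part of the discharge programme of the named fact
`Literature.NumberTheory.LFunctions.RosserSchoenfeld1962_eq_3_22` (J. B. Rosser, L. Schoenfeld,
Illinois J. Math. 6 (1962), 64–94, Thm. 6 (3.22): `∑_{p ≤ x} (log p)/p < log x + E + 1/(2 log x)`
for `x ≥ 319`, `E = −γ − ∑_p (log p)/(p(p−1)) = −1.33258…`). Rosser–Schoenfeld settle the range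
below `10⁸` by the Rosser–Walker and Appel–Rosser tabulations (p. 87); in the tree the analytic
argument takes over at `e¹³`, and the finite range `319 ≤ x ≤ 442439` (`442439` the first prime
beyond `e¹³ = 442413.39…`) is a statement about the `37129` primes `≤ 442439`, certified by the
kernel. This file is the *computable core*, the exact analogue for `S(x) = ∑_{p ≤ x} (log p)/p` of
the `θ`-chain checker `ThetaChainCheck.lean` (whose table `ChainTable.table`, primality test
`ThetaChain.primeChk` and logarithm step `ThetaChain.logNext` it reuses); the semantic soundness is
`MertensFirstChainSound.lean`, the run and the assembly are `MertensFirstChainRun*.lean`,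
`MertensFirstSmallRange.lean`.

## The state and one step

A state `⟨p, Llo, Lhi, Shi, Ghi⟩` records the last prime `p` reached, natural-number enclosures
`Llo ≤ 2⁸⁰ log p ≤ Lhi`, and natural-number MAJORANTS `2⁸⁰ S(p) ≤ Shi`,
`2⁸⁰ ∑_{q ≤ p} (log q)/(q(q−1)) ≤ Ghi` (the second feeds the lower bound for `E`). A step to the next
table entry `p'` (`stepM`) checks `p < p'`, `p'` odd and prime (`primeChk`), extends the logarithm
(`logNext`), sets `Shi' = Shi + ⌊Lhi'/p'⌋ + 1`, `Ghi' = Ghi + ⌊Lhi'/(p'(p'−1))⌋ + 1`, and performs the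
comparison behind (3.22) at the new prime once `p' ≥ 331` (`chkM`):
`Shi' + ELO < Llo' + ⌊2¹⁶⁰/(2 Lhi')⌋`, where `ELO = ⌈1.3329 · 2⁸⁰⌉` (so that `E ≥ −ELO/2⁸⁰`,
proved in `MertensFirstSmallRange.lean` from the final `Ghi`); since `S` is constant between primes
and `log x + 1/(2 log x)` increases, this certifies (3.22) on `[p', p'')`. The interval `[319, 331)`
(`S = S(317)` there; `317 < 319 < 331` are consecutive primes around `319`) is certified by the extra
comparison `chk319` performed at the step `317 → 331`, with `log 319` from `ChainCheck.logN`.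

All arithmetic is on `ℕ` with the kernel's GMP-accelerated primitives, as in `ChainCheck.lean`.
Nothing is asserted in this file: the `def`s are the computable functions and constants.

## References

* J. B. Rosser, L. Schoenfeld, *Approximate formulas for some functions of prime numbers*,
  Illinois J. Math. 6 (1962), 64–94, Thm. 6 (3.22) and p. 87 (the range below `10⁸` by tables).
  [RosserSchoenfeld1962]
-/

namespace Literature.NumberTheory.LFunctions.MertensFirstChain

open ChainCheck ChainTable ThetaChain

/-! ### Constants -/

/-- `ELO = ⌈1.3329 · 2⁸⁰⌉`; the checks use `E ≥ −ELO/2⁸⁰` (`E = −1.33258 22757…`, (2.11)).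
[cite: RosserSchoenfeld1962, (2.11)] -/
def ELO : ℕ := 1611377224964339226965862

/-! ### States, the comparison, one step, the run -/

/-- A state of the Mertens chain: the prime `p` reached, `Llo ≤ 2⁸⁰ log p ≤ Lhi`,
`2⁸⁰ ∑_{q ≤ p} (log q)/q ≤ Shi`, `2⁸⁰ ∑_{q ≤ p} (log q)/(q(q−1)) ≤ Ghi`. [folklore] -/
structure MS where
  /-- the last prime reached -/
  p : ℕ
  /-- lower bound of `2⁸⁰ log p` -/
  Llo : ℕ
  /-- upper bound of `2⁸⁰ log p` -/
  Lhi : ℕ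
  /-- upper bound of `2⁸⁰ ∑_{q ≤ p} (log q)/q` -/
  Shi : ℕ
  /-- upper bound of `2⁸⁰ ∑_{q ≤ p} (log q)/(q(q−1))` -/
  Ghi : ℕ
  deriving Repr, DecidableEq

/-- `chkM Shi Llo Lhi`: the test `Shi + ELO < Llo + ⌊2¹⁶⁰/(2·Lhi)⌋`; with `Llo ≤ 2⁸⁰ log x ≤ Lhi` it
implies `Shi + ELO < 2⁸⁰ (log x + 1/(2 log x))` (`chkM_sound`). [folklore] -/
def chkM (Shi Llo Lhi : ℕ) : Bool :=
  Nat.blt (Nat.add Shi ELO) (Nat.add Llo (Nat.div P160 (Nat.mul 2 Lhi)))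

/-- The comparison for the interval `[319, 331)`: `chkM` against the enclosure of `log 319` from
`ChainCheck.logN`. [folklore] -/
def chk319 (Shi : ℕ) : Bool :=
  match logN 319 with
  | some (lo3, hi3) => chkM Shi lo3 hi3
  | none => false

/-- **One step** of the Mertens chain, to the next table entry `p'`: order, parity and primality of
`p'`; the `[319, 331)` check when `p' = 331`; the new enclosures and majorants; the check at `p'`
(if `p' ≥ 331`). [folklore] -/
def stepM (s : MS) (p' : ℕ) : Option MS :=
  match s with
  | ⟨p, Llo, Lhi, Shi, Ghi⟩ =>
    bif !(Nat.blt p p' && Nat.beq (Nat.mod p' 2) 1 && primeChk p') then none else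
    bif !(!(Nat.beq p' 331) || chk319 Shi) then none else
    match logNext p Llo Lhi p' with
    | none => none
    | some (Llo', Lhi') =>
      let Shi' := Nat.add (Nat.add Shi (Nat.div Lhi' p')) 1
      let Ghi' := Nat.add (Nat.add Ghi (Nat.div Lhi' (Nat.mul p' (Nat.sub p' 1)))) 1
      bif !(Nat.blt p' 331 || chkM Shi' Llo' Lhi') then none
      else some ⟨p', Llo', Lhi', Shi', Ghi'⟩

/-- Run over a segment of the table with fuel (a chunk): stops successfully when the fuel or the
segment is exhausted, fails as soon as a step fails. [folklore] -/
def runM : ℕ → MS → List ℕ → Option MS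
  | 0, s, _ => some s
  | _ + 1, s, [] => some s
  | fuel + 1, s, p' :: rest =>
    match stepM s p' with
    | none => none
    | some s' => runM fuel s' rest

/-- The initial state: `p = 2`, `S(2) = (log 2)/2`, `∑_{q ≤ 2} (log q)/(q(q−1)) = (log 2)/2`
(`2⁸⁰ log 2 ≤ L2HIN`). [folklore] -/
def initM : MS := ⟨2, L2LON, L2HIN, Nat.add (Nat.div L2HIN 2) 1, Nat.add (Nat.div L2HIN 2) 1⟩

/-- **A chunk of the run**: at most `fuel` entries of `ChainTable.table` after the state's prime.
[folklore] -/
def runDM (fuel : ℕ) (s : MS) : Option MS := runM fuel s (ChainCheck.after s.p table)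

end Literature.NumberTheory.LFunctions.MertensFirstChain
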